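import Mathlib
import Literature.MathematicalPhysics.MHD.HainLustSigmaStability
import Summits.Ventures.FusionMHD.Models.KinkEqScrewPinchQ07
import Summits.Ventures.FusionMHD.Models.KinkEqScrewPinchQ07WitnessData
import HarnessLib

/-!
# F3.σ #95 «F3.σ-KINK-UNSTABLE»: the Hain–Lüst / Freidberg (11.130)–(11.134) coefficient blocks of MODEL M_kink (`KinkEqQ07.hlK`) at the
# helicity `(m, k) = (1, −1/5)` and `ω² = −σ² = −10⁻⁴`, in CLOSED FORM (exact rational functions of `r`)

Companion of `Models/KinkEqScrewPinchQ07Witness.lean` (seat `gridfusion-sos-6` g5, 2026-08-27; generator `HOME/cert/sos-6/kink/`).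
With `H(r) = hlDnum` (Data file; `> 0` on `[0, 1]`): `V_S²`, `V_A²`, `V_S² + V_A²`, `ω_a²`, `B²`, `D = H/(720300000000·r²(1+r²)⁴)`
(= GP2004's `D` since `ρ ≡ 1`), `ω_h²`, `ω_g²`, `A = −r·A_N/(980(1+r²)²H)`, `Br = −4B_N/(49(1+r²)²H)`, `C₀ = −C_N/(490000·r(1+r²)²H)`,
`τ = −8(5 + 18r²)/(49(1+r²)²(25+r²))` and `τ′ = 48r(−65 + 155r² + 12r⁴)/(49(1+r²)³(25+r²)²)` (the derivative of the REGULAR closed form,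
transported to `s ↦ τ(s)` on the punctured neighbourhood of `r ≠ 0` — `B_θ²/r² = u²` off the axis).  Every identity is
`simp only [defs]; field_simp; ring` on lit-4's `hlK`, `uK`, `pK` BY NAME.  Nothing here is a stability statement.  [instance data]
-/

noncomputable section

open Set Polynomial Literature.MathematicalPhysics.MHD
open Literature.Analysis.ValidatedNumerics Literature.Analysis.ValidatedNumerics.ExpPoly

namespace Summit.Ventures.FusionMHD.Models.KinkEqQ07

/-! ### §2 The model blocks of `hlK` at `(m, k) = (1, −1/5)`, `ω² = −σ² = −10⁻⁴`, in closed form -/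

/-- `V_S² = γp/ρ` explicitly. [instance data] -/
theorem soundSpeedSq_eqK (r : ℝ) : hlK.soundSpeedSq r = (151 - 98 * r ^ 2 - 49 * r ^ 4) / (2940 * (1 + r ^ 2) ^ 2) := by
  have h1 : (1 : ℝ) + r ^ 2 ≠ 0 := by positivity
  simp only [ScrewPinch.DynProfile.soundSpeedSq, hlK, pK]
  field_simp
  ring

/-- `V_A² = B²/(μ₀ρ)` explicitly. [instance data] -/
theorem alfvenSpeedSq_eqK (r : ℝ) : hlK.alfvenSpeedSq r = (49 + 102 * r ^ 2 + 49 * r ^ 4) / (49 * (1 + r ^ 2) ^ 2) := by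
  have h1 : (1 : ℝ) + r ^ 2 ≠ 0 := by positivity
  simp only [ScrewPinch.DynProfile.alfvenSpeedSq, ScrewPinch.DynProfile.Bsq, hlK, uK]
  field_simp
  ring

/-- `V_S² + V_A²` explicitly (manifestly positive). [instance data] -/
theorem speedSum_eqK (r : ℝ) : hlK.soundSpeedSq r + hlK.alfvenSpeedSq r = (3091 + 6022 * r ^ 2 + 2891 * r ^ 4) / (2940 * (1 + r ^ 2) ^ 2) := by
  rw [soundSpeedSq_eqK, alfvenSpeedSq_eqK]
  have h1 : (0 : ℝ) < (1 + r ^ 2) ^ 2 := by positivity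
  rw [div_add_div _ _ (by positivity) (by positivity), div_eq_div_iff (by positivity) (by positivity)]
  ring

/-- `ω_a² = F²/(μ₀ρ)` explicitly (`F = k + u` for `r ≠ 0`). [instance data] -/
theorem alfvenFreqSq_eqK {r : ℝ} (hr : r ≠ 0) : hlK.alfvenFreqSq 1 (-1 / 5) r = (3 - 7 * r ^ 2) ^ 2 / (1225 * (1 + r ^ 2) ^ 2) := by
  have h1 : (1 : ℝ) + r ^ 2 ≠ 0 := by positivity
  simp only [ScrewPinch.DynProfile.alfvenFreqSq, ScrewPinch.Profile.kDotB, hlK, uK]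
  field_simp
  ring

/-- `B²` explicitly. [instance data] -/
theorem bsq_eqK (r : ℝ) : hlK.Bsq r = (49 + 102 * r ^ 2 + 49 * r ^ 4) / (49 * (1 + r ^ 2) ^ 2) := by
  have h1 : (1 : ℝ) + r ^ 2 ≠ 0 := by positivity
  simp only [ScrewPinch.DynProfile.Bsq, hlK, uK]
  field_simp
  ring

/-- `D(r; −10⁻⁴) = H(r)/(720300000000·r²(1+r²)⁴)` for `r ≠ 0`. [instance data] -/
theorem hlD_eqK {r : ℝ} (hr : r ≠ 0) :
    hlK.hlD 1 (-1 / 5) (-(1 / 100) ^ 2) r = hlDnum r / (720300000000 * r ^ 2 * (1 + r ^ 2) ^ 4) := by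
  have h1 : (1 : ℝ) + r ^ 2 ≠ 0 := by positivity
  simp only [ScrewPinch.DynProfile.hlD, ScrewPinch.Profile.k0Sq]
  rw [soundSpeedSq_eqK, alfvenSpeedSq_eqK, alfvenFreqSq_eqK hr]
  unfold hlDnum
  field_simp
  ring

/-- GP2004's `D(r; −10⁻⁴) = ρ²·D_Freidberg = H(r)/(720300000000·r²(1+r²)⁴)` for `r ≠ 0` (`ρ ≡ 1`). [instance data] -/
theorem hlDGP_eqK {r : ℝ} (hr : r ≠ 0) :
    hlK.hlDGP 1 (-1 / 5) (-(1 / 100) ^ 2) r = hlDnum r / (720300000000 * r ^ 2 * (1 + r ^ 2) ^ 4) := by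
  rw [ScrewPinch.DynProfile.hlDGP_eq (by show (1 : ℝ) ≠ 0; norm_num) (by show (1 : ℝ) ≠ 0; norm_num), hlD_eqK hr]
  show (1 : ℝ) ^ 2 * _ = _
  ring

/-- `ω_h² = V_S²ω_a²/(V_S² + V_A²)` explicitly (`r ≠ 0`). [instance data] -/
theorem slowFreqSq_eqK {r : ℝ} (hr : r ≠ 0) : hlK.slowFreqSq 1 (-1 / 5) r
    = (151 - 98 * r ^ 2 - 49 * r ^ 4) * (3 - 7 * r ^ 2) ^ 2 / (1225 * (1 + r ^ 2) ^ 2 * (3091 + 6022 * r ^ 2 + 2891 * r ^ 4)) := by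
  have h1 : (1 : ℝ) + r ^ 2 ≠ 0 := by positivity
  have h2 : (3091 : ℝ) + 6022 * r ^ 2 + 2891 * r ^ 4 ≠ 0 := by positivity
  unfold ScrewPinch.DynProfile.slowFreqSq
  rw [speedSum_eqK, soundSpeedSq_eqK, alfvenFreqSq_eqK hr]
  field_simp

/-- `ω_g² = V_S²ω_a²/V_A²` explicitly (`r ≠ 0`). [instance data] -/
theorem cuspFreqSq_eqK {r : ℝ} (hr : r ≠ 0) : hlK.cuspFreqSq 1 (-1 / 5) r
    = (151 - 98 * r ^ 2 - 49 * r ^ 4) * (3 - 7 * r ^ 2) ^ 2 / (1225 * 60 * (1 + r ^ 2) ^ 2 * (49 + 102 * r ^ 2 + 49 * r ^ 4)) := by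
  have h1 : (1 : ℝ) + r ^ 2 ≠ 0 := by positivity
  have h2 : (49 : ℝ) + 102 * r ^ 2 + 49 * r ^ 4 ≠ 0 := by positivity
  unfold ScrewPinch.DynProfile.cuspFreqSq
  rw [soundSpeedSq_eqK, alfvenSpeedSq_eqK, alfvenFreqSq_eqK hr]
  field_simp
  ring

/-- `A(r; −10⁻⁴) = −r·A_N(r)/(980(1+r²)²H(r))` on `(0, 1]`. [instance data] -/
theorem hlA_eqK {r : ℝ} (hr : 0 < r) (hr1 : r ≤ 1) : hlK.hlA 1 (-1 / 5) (-(1 / 100) ^ 2) r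
    = -(r * ((-2536270291 : ℝ) + (19970938414 : ℝ) * r ^ 2 + (-71318261525 : ℝ) * r ^ 4 + (135657923940 : ℝ) * r ^ 6
        + (-110076820525 : ℝ) * r ^ 8 + (-3472772786 : ℝ) * r ^ 10 + (16087441909 : ℝ) * r ^ 12)) / (980 * (1 + r ^ 2) ^ 2 * hlDnum r) := by
  have hr0 : r ≠ 0 := hr.ne'
  have h1 : (1 : ℝ) + r ^ 2 ≠ 0 := by positivity
  have h2 : (3091 : ℝ) + 6022 * r ^ 2 + 2891 * r ^ 4 ≠ 0 := by positivity
  have hH : hlDnum r ≠ 0 := (hlDnum_pos hr.le hr1).ne'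
  unfold ScrewPinch.DynProfile.hlA
  rw [hlD_eqK hr0, speedSum_eqK, alfvenFreqSq_eqK hr0, slowFreqSq_eqK hr0]
  simp only [hlK]
  field_simp
  ring

/-- `Br(r; −10⁻⁴) = −4B_N(r)/(49(1+r²)²H(r))` on `(0, 1]`. [instance data] -/
theorem hlBr_eqK {r : ℝ} (hr : 0 < r) (hr1 : r ≤ 1) : hlK.hlBr 1 (-1 / 5) (-(1 / 100) ^ 2) r
    = -(4 * ((139011800 : ℝ) + (42114477 : ℝ) * r ^ 2 + (-587408892 : ℝ) * r ^ 4 + (3721385262 : ℝ) * r ^ 6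
        + (-537603892 : ℝ) * r ^ 8 + (-589500723 : ℝ) * r ^ 10)) / (49 * (1 + r ^ 2) ^ 2 * hlDnum r) := by
  have hr0 : r ≠ 0 := hr.ne'
  have h1 : (1 : ℝ) + r ^ 2 ≠ 0 := by positivity
  have h2 : (3091 : ℝ) + 6022 * r ^ 2 + 2891 * r ^ 4 ≠ 0 := by positivity
  have hH : hlDnum r ≠ 0 := (hlDnum_pos hr.le hr1).ne'
  unfold ScrewPinch.DynProfile.hlBr
  rw [hlD_eqK hr0, speedSum_eqK, slowFreqSq_eqK hr0]
  simp only [ScrewPinch.DynProfile.kPerpB, hlK, uK]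
  field_simp
  simp only [hlDnum]
  ring

/-- `C₀(r; −10⁻⁴) = −C_N(r)/(490000·r(1+r²)²H(r))` on `(0, 1]`. [instance data] -/
theorem hlC0_eqK {r : ℝ} (hr : 0 < r) (hr1 : r ≤ 1) : hlK.hlC0 1 (-1 / 5) (-(1 / 100) ^ 2) r
    = -((-1268135145500 : ℝ) + (12135229517433 : ℝ) * r ^ 2 + (-42624816824702 : ℝ) * r ^ 4 + (83418714723295 : ℝ) * r ^ 6
        + (-53955921218640 : ℝ) * r ^ 8 + (-6550605059705 : ℝ) * r ^ 10 + (7973819676298 : ℝ) * r ^ 12 + (321607306433 : ℝ) * r ^ 14) / (490000 * r * (1 + r ^ 2) ^ 2 * hlDnum r) := by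
  have hr0 : r ≠ 0 := hr.ne'
  have h1 : (1 : ℝ) + r ^ 2 ≠ 0 := by positivity
  have h2 : (49 : ℝ) + 102 * r ^ 2 + 49 * r ^ 4 ≠ 0 := by positivity
  have hH : hlDnum r ≠ 0 := (hlDnum_pos hr.le hr1).ne'
  unfold ScrewPinch.DynProfile.hlC0
  rw [hlD_eqK hr0, alfvenSpeedSq_eqK, alfvenFreqSq_eqK hr0, cuspFreqSq_eqK hr0]
  simp only [hlK, uK]
  field_simp
  simp only [hlDnum]
  ring

/-- `τ(r) = −8(5 + 18r²)/(49(1+r²)²(25+r²))` for `r ≠ 0` (the axis factor `B_θ²/r² = u²` is regular). [instance data] -/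
theorem margTau_eqK {r : ℝ} (hr : r ≠ 0) :
    hlK.margTau 1 (-1 / 5) r = -(8 * (5 + 18 * r ^ 2)) / (49 * (1 + r ^ 2) ^ 2 * (25 + r ^ 2)) := by
  have h1 : (1 : ℝ) + r ^ 2 ≠ 0 := by positivity
  have h25 : (25 : ℝ) + r ^ 2 ≠ 0 := by positivity
  have hK : (1 : ℝ) ^ 2 + (-1 / 5) ^ 2 * r ^ 2 ≠ 0 := by positivity
  simp only [ScrewPinch.DynProfile.margTau, ScrewPinch.DynProfile.kPerpB, hlK, uK]
  field_simp
  ring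

/-- The regularised `τ` as a quotient of real polynomials: numerator. [instance data] -/
def TNP : ℝ[X] := C (-(40/49) : ℝ) + C (-(144/49) : ℝ) * X ^ 2

/-- … and denominator `(1+r²)²(25+r²)`. [instance data] -/
def TDP : ℝ[X] := C (25 : ℝ) + C (51 : ℝ) * X ^ 2 + C (27 : ℝ) * X ^ 4 + X ^ 6

/-- `TDP > 0`. [instance data] -/
theorem TDP_eval_pos (r : ℝ) : 0 < (TDP).eval r := by
  simp only [TDP, eval_add, eval_mul, eval_C, eval_X, eval_pow]
  positivity

/-- `τ = TNP/TDP` off the axis. [instance data] -/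
theorem margTau_eq_polyK {r : ℝ} (hr : r ≠ 0) : hlK.margTau 1 (-1 / 5) r = (TNP).eval r / (TDP).eval r := by
  rw [margTau_eqK hr]
  have h1 : (1 : ℝ) + r ^ 2 ≠ 0 := by positivity
  have h25 : (25 : ℝ) + r ^ 2 ≠ 0 := by positivity
  have hT : (TDP).eval r ≠ 0 := (TDP_eval_pos r).ne'
  simp only [TNP, TDP, eval_add, eval_mul, eval_C, eval_X, eval_pow] at hT ⊢
  field_simp
  ring

/-- `τ′(r) = 48r(−65 + 155r² + 12r⁴)/(49(1+r²)³(25+r²)²)` for `r ≠ 0` (derivative of the regular closed form, transported to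
`s ↦ τ(s)` on the punctured neighbourhood). [instance data] -/
theorem deriv_margTau_eqK {r : ℝ} (hr : r ≠ 0) : deriv (fun s => hlK.margTau 1 (-1 / 5) s) r
    = 48 * r * (-65 + 155 * r ^ 2 + 12 * r ^ 4) / (49 * (1 + r ^ 2) ^ 3 * (25 + r ^ 2) ^ 2) := by
  have hT : (TDP).eval r ≠ 0 := (TDP_eval_pos r).ne'
  have hq : HasDerivAt (fun s => (TNP).eval s / (TDP).eval s)
      (((derivative TNP).eval r * (TDP).eval r - (TNP).eval r * (derivative TDP).eval r) / (TDP).eval r ^ 2) r :=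
    ((TNP).hasDerivAt r).div ((TDP).hasDerivAt r) hT
  have hev : (fun s => hlK.margTau 1 (-1 / 5) s) =ᶠ[nhds r] (fun s => (TNP).eval s / (TDP).eval s) := by
    filter_upwards [isOpen_ne.mem_nhds hr] with s hs
    exact margTau_eq_polyK hs
  rw [hev.deriv_eq, hq.deriv]
  have h1 : (1 : ℝ) + r ^ 2 ≠ 0 := by positivity
  have h25 : (25 : ℝ) + r ^ 2 ≠ 0 := by positivity
  simp only [TNP, TDP, derivative_add, derivative_mul, derivative_C, derivative_X_pow,
    eval_add, eval_mul, eval_C, eval_X, eval_pow, zero_mul, zero_add] at hT ⊢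
  push_cast
  field_simp
  ring

end Summit.Ventures.FusionMHD.Models.KinkEqQ07

end
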